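import Mathlib
import HarnessLib
import Literature.Analysis.FluidPDE.SuitableWeak
import Literature.Analysis.FluidPDE.LocalTypeI
import Literature.Analysis.FluidPDE.LocalTypeIReverseTools
import Literature.Analysis.FluidPDE.Seregin2020CubicLowerBound

/-!
# Crux `TypeIQuarterGate.ScarEnvelopeTypeI` (stmt-NavierStokesRegularity-23843), line `slice_budget` —
# CKN AT THE TOP TIME, file 1: ε-regularity in dissipation form at a vertex on the final time,
# under an energy bound

Helper file (no new definitions) for the deciding stub SD `stub_sliceOctaveBudget` of line
`slice_budget`.  The NULL TABLE of ROUND-28 (nsreg-p3) says that, under the Type-I rate and the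
slice-wise `L²` (Morrey) bound, a failure of the slice-wise octave budget is carried by a
CONCENTRATION SET in a far annulus.  Zooming at the concentration's own scale produces a local
suitable weak solution (Albritton–Barker class) whose FINAL-TIME singular set contains the limit of
the concentration sets.  Files 1–2 prove the tool that kills every such scenario whose limit set has
positive one-dimensional Hausdorff measure (coherent filaments, arc-like swarms, sheets, fog).  Here:

* `exists_bound_top_of_cknE_le` — ε-REGULARITY IN `E`-FORM AT A TOP VERTEX, GIVEN AN ENERGY BOUND:
  for a suitable weak pair `(u, p)` (unit viscosity, no force) on an open `Q ⊇ Q_{R₀}(z)` with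
  `D(R₀; z) < ∞`, if `A(ρ; z) ≤ K` and `E(ρ; z) ≤ η₀(K)` for all `0 < ρ ≤ R₀`, then `u` is essentially
  bounded on some backward cylinder `Q_r(z)`; `z` may lie ON THE TOP TIME of `Q` (only backward
  cylinders enter).  Proof: the decay interpolation `C(κϱ) ≤ C₆[κ³A^{3/2} + κ⁻³A^{3/4}E^{3/4}]`
  (Seregin 2014 L.6.2 = the tree's `Seregin2020.exists_cknC_le_decay`), the pressure decay
  `D(θϱ) ≤ κ₇θ⁻²A^{1/2}E + κ₈θD(ϱ)` (L.6.4 = `Seregin2020.pressureEstimateMeanZero_top`) iterated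
  along `ϱ = θⁿR₀` (`iterate_quarter_le`), and the one-scale criterion at cylinders touching the top
  (`Seregin2020.exists_epsilonRegularity_top`, CKN 1982 Prop. 1 / Seregin 2020 Prop. 1.4 (1)).
* `not_isBackwardSingularPoint_of_cknE_le` — contrapositive packaging (Albritton–Barker's backward
  singular points, `IsBackwardSingularPoint`).

File 2 (`…TopTimeCKN.lean`) derives the `H¹`-nullity of top-time singular sets.  [Seregin 2014,
§6 p. 108 and §7.2: «by the ε-regularity theory, one-dimensional Hausdorff's measure of singular
points at the blow up time is equal to zero».]

HONEST FRAMING: tools only; SD, the crux `ScarEnvelopeTypeI`, its parent and the summit are OPEN and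
nothing here is credited toward them.
-/

noncomputable section

-- the summit-side namespace `Summit.NavierStokesRegularity.NavierStokesRegularity.…` (single-conjunct
-- summit, D-0017) repeats a component by design; the dupNamespace linter would flag every declaration.
set_option linter.dupNamespace false

namespace Summit.NavierStokesRegularity.NavierStokesRegularity.Cruxes.ScarEnvelopeTypeI.SliceBudget

open MeasureTheory Set Function Filter Topology TopologicalSpace Metric
open scoped NNReal ENNReal
open Literature.Analysis Literature.Analysis.FluidPDE Literature.Analysis.FluidPDE.Seregin2020

/-! ### A geometric iteration in `ℝ≥0∞` -/

/-- If `d (n+1) ≤ B + ¼ d n` for all `n`, then `d n ≤ (¼)ⁿ d 0 + 2B`. -/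
theorem iterate_quarter_le {d : ℕ → ℝ≥0∞} {B : ℝ≥0∞}
    (h : ∀ n, d (n + 1) ≤ B + ENNReal.ofReal (1 / 4) * d n) (n : ℕ) :
    d n ≤ ENNReal.ofReal (1 / 4) ^ n * d 0 + 2 * B := by
  induction n with
  | zero => simp
  | succ n ih =>
    have h14 : ENNReal.ofReal (1 / 4) * (2 * B) ≤ B := by
      rw [← mul_assoc, ← ENNReal.ofReal_ofNat 2, ← ENNReal.ofReal_mul (by norm_num)]
      calc ENNReal.ofReal (1 / 4 * 2) * B ≤ 1 * B := by
            gcongr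
            rw [← ENNReal.ofReal_one]
            exact ENNReal.ofReal_le_ofReal (by norm_num)
        _ = B := one_mul B
    calc d (n + 1) ≤ B + ENNReal.ofReal (1 / 4) * d n := h n
      _ ≤ B + ENNReal.ofReal (1 / 4) * (ENNReal.ofReal (1 / 4) ^ n * d 0 + 2 * B) := by gcongr
      _ = ENNReal.ofReal (1 / 4) ^ (n + 1) * d 0 + (B + ENNReal.ofReal (1 / 4) * (2 * B)) := by
          rw [mul_add, pow_succ]; ring
      _ ≤ ENNReal.ofReal (1 / 4) ^ (n + 1) * d 0 + (B + B) := by gcongr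
      _ = ENNReal.ofReal (1 / 4) ^ (n + 1) * d 0 + 2 * B := by rw [two_mul]

/-! ### ε-regularity in `E`-form at a top vertex, given an energy bound -/

/-- **ε-regularity in dissipation form at a vertex on the top time, under an energy bound.**  For
every `K` there is `η₀ > 0` such that: if `(u, p)` is a suitable weak solution (`ν = 1`, no force) on
an open `Q`, `G` a weak spatial gradient of `u` on `Q`, `Q_{R₀}(z) ⊆ Q` with `D(R₀; z) < ∞`, and for
all `0 < ρ ≤ R₀` the scaled energy satisfies `A(ρ; z) ≤ K` and the scaled dissipation
`E(ρ; z) ≤ η₀`, then `u` is essentially bounded on some backward cylinder `Q_r(z)`, `r > 0`.  The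
vertex `z` may lie on the top time of `Q`.  (Seregin 2014, Lemmas 6.2, 6.4 and the one-scale
criterion, assembled at cylinders touching the top.) -/
theorem exists_bound_top_of_cknE_le (K : ℝ≥0) :
    ∃ η₀ : ℝ, 0 < η₀ ∧
      ∀ (Q : Opens (ℝ × EuclideanSpace ℝ (Fin 3)))
        (u : ℝ → EuclideanSpace ℝ (Fin 3) → EuclideanSpace ℝ (Fin 3))
        (p : ℝ → EuclideanSpace ℝ (Fin 3) → ℝ)
        (G : ℝ → EuclideanSpace ℝ (Fin 3) → EuclideanSpace ℝ (Fin 3) →L[ℝ] EuclideanSpace ℝ (Fin 3)),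
        IsSuitableWeakSolutionOn Q 1 0 u p → HasWeakSpatialGradientOn Q u G →
        ∀ (z : ℝ × EuclideanSpace ℝ (Fin 3)) (R₀ : ℝ), 0 < R₀ →
          parabolicCylinder R₀ z ⊆ (Q : Set (ℝ × EuclideanSpace ℝ (Fin 3))) →
          cknD R₀ z p ≠ ∞ →
          (∀ ρ, 0 < ρ → ρ ≤ R₀ → cknAEss ρ z u ≤ K) →
          (∀ ρ, 0 < ρ → ρ ≤ R₀ → cknE ρ z G ≤ ENNReal.ofReal η₀) →
          ∃ r : ℝ, 0 < r ∧ ∃ C : ℝ,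
            ∀ᵐ w ∂(volume.restrict (parabolicCylinder r z)), ‖u w.1 w.2‖ ≤ C := by
  -- ### the constants of the three tree estimates
  obtain ⟨ε₀, C₀, hε₀, hC₀, HE⟩ := exists_epsilonRegularity_top
  obtain ⟨C₆, hC₆⟩ := exists_cknC_le_decay
  obtain ⟨κ₇, κ₈, HP⟩ := pressureEstimateMeanZero_top
  -- ### the target unit `q5 = ε₀³ / 5`
  set q5 : ℝ≥0∞ := ENNReal.ofReal (ε₀ ^ 3 / 5) with hq5
  have hq50 : q5 ≠ 0 := (ENNReal.ofReal_pos.2 (by positivity)).ne'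
  have h5q5 : q5 + q5 + q5 + q5 + q5 = ENNReal.ofReal (ε₀ ^ 3) := by
    rw [hq5, ← ENNReal.ofReal_add (by positivity) (by positivity),
      ← ENNReal.ofReal_add (by positivity) (by positivity),
      ← ENNReal.ofReal_add (by positivity) (by positivity),
      ← ENNReal.ofReal_add (by positivity) (by positivity)]
    congr 1; ring
  have hKt : ∀ e : ℝ, 0 ≤ e → (K : ℝ≥0∞) ^ e ≠ ∞ := fun e he =>
    ENNReal.rpow_ne_top_of_nonneg he ENNReal.coe_ne_top
  -- ### the ratio `θ` of the pressure iteration: `θ ≤ 1/2`, `κ₈ θ ≤ 1/4`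
  have h14 : (ENNReal.ofReal (1 / 4) : ℝ≥0∞) ≠ 0 := (ENNReal.ofReal_pos.2 (by norm_num)).ne'
  obtain ⟨θa, hθa, Hθa⟩ := exists_small_mul_rpow_le (c := (κ₈ : ℝ≥0∞)) ENNReal.coe_ne_top h14 one_pos
  set θ : ℝ := min (1 / 2) θa with hθdef
  have hθ0 : 0 < θ := lt_min (by norm_num) hθa
  have hθhalf : θ ≤ 1 / 2 := min_le_left _ _
  have hθ1 : θ ≤ 1 := hθhalf.trans (by norm_num)
  have hκ₈θ : (κ₈ : ℝ≥0∞) * ENNReal.ofReal θ ≤ ENNReal.ofReal (1 / 4) := by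
    have := Hθa θ ⟨hθ0, min_le_right _ _⟩
    rwa [ENNReal.rpow_one] at this
  set Yθ : ℝ≥0∞ := ENNReal.ofReal ((θ ^ 2)⁻¹) with hYθ
  -- ### the ratio `κ` of the final scale: `κ ≤ 1/2`, `C₆ κ³ K^{3/2} ≤ q5`
  obtain ⟨κa, hκa, Hκa⟩ := exists_small_mul_rpow_le (c := (C₆ : ℝ≥0∞) * (K : ℝ≥0∞) ^ (3 / 2 : ℝ))
    (ENNReal.mul_ne_top ENNReal.coe_ne_top (hKt _ (by norm_num))) hq50 (by norm_num : (0 : ℝ) < 3)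
  set κ : ℝ := min (1 / 2) κa with hκdef
  have hκ0 : 0 < κ := lt_min (by norm_num) hκa
  have hκhalf : κ ≤ 1 / 2 := min_le_left _ _
  have hκ1 : κ ≤ 1 := hκhalf.trans (by norm_num)
  set X : ℝ≥0∞ := ENNReal.ofReal κ with hX
  have hX0 : X ≠ 0 := (ENNReal.ofReal_pos.2 hκ0).ne'
  set Xi : ℝ≥0∞ := ENNReal.ofReal κ⁻¹ with hXi
  set Y : ℝ≥0∞ := ENNReal.ofReal ((κ ^ 2)⁻¹) with hY
  have HT1 : (C₆ : ℝ≥0∞) * (K : ℝ≥0∞) ^ (3 / 2 : ℝ) * X ^ 3 ≤ q5 := by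
    have := Hκa κ ⟨hκ0, min_le_right _ _⟩
    rwa [show (3 : ℝ) = ((3 : ℕ) : ℝ) by norm_num, ENNReal.rpow_natCast] at this
  -- ### the dissipation threshold `η₀`: three smallness conditions
  obtain ⟨ηa, hηa, Hηa⟩ := exists_small_mul_rpow_le
    (c := (C₆ : ℝ≥0∞) * Xi ^ 3 * (K : ℝ≥0∞) ^ (3 / 4 : ℝ))
    (ENNReal.mul_ne_top (ENNReal.mul_ne_top ENNReal.coe_ne_top (ENNReal.pow_ne_top ENNReal.ofReal_ne_top))
      (hKt _ (by norm_num))) hq50 (by norm_num : (0 : ℝ) < 3 / 4)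
  obtain ⟨ηb, hηb, Hηb⟩ := exists_small_mul_rpow_le
    (c := (κ₇ : ℝ≥0∞) * Y * (K : ℝ≥0∞) ^ (1 / 2 : ℝ))
    (ENNReal.mul_ne_top (ENNReal.mul_ne_top ENNReal.coe_ne_top ENNReal.ofReal_ne_top)
      (hKt _ (by norm_num))) hq50 one_pos
  obtain ⟨ηc, hηc, Hηc⟩ := exists_small_mul_rpow_le
    (c := (κ₈ : ℝ≥0∞) * X * (2 * ((κ₇ : ℝ≥0∞) * Yθ * (K : ℝ≥0∞) ^ (1 / 2 : ℝ))))
    (ENNReal.mul_ne_top (ENNReal.mul_ne_top ENNReal.coe_ne_top ENNReal.ofReal_ne_top)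
      (ENNReal.mul_ne_top ENNReal.ofNat_ne_top (ENNReal.mul_ne_top
        (ENNReal.mul_ne_top ENNReal.coe_ne_top ENNReal.ofReal_ne_top) (hKt _ (by norm_num))))) hq50 one_pos
  set η₀ : ℝ := min ηa (min ηb ηc) with hη₀def
  have hη₀ : 0 < η₀ := lt_min hηa (lt_min hηb hηc)
  set η : ℝ≥0∞ := ENNReal.ofReal η₀ with hη
  have HT2 : (C₆ : ℝ≥0∞) * Xi ^ 3 * (K : ℝ≥0∞) ^ (3 / 4 : ℝ) * η ^ (3 / 4 : ℝ) ≤ q5 :=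
    Hηa η₀ ⟨hη₀, min_le_left _ _⟩
  have HT3 : (κ₇ : ℝ≥0∞) * Y * (K : ℝ≥0∞) ^ (1 / 2 : ℝ) * η ≤ q5 := by
    have := Hηb η₀ ⟨hη₀, (min_le_right _ _).trans (min_le_left _ _)⟩
    rwa [ENNReal.rpow_one] at this
  have HT5 : (κ₈ : ℝ≥0∞) * X * (2 * ((κ₇ : ℝ≥0∞) * Yθ * (K : ℝ≥0∞) ^ (1 / 2 : ℝ))) * η ≤ q5 := by
    have := Hηc η₀ ⟨hη₀, (min_le_right _ _).trans (min_le_right _ _)⟩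
    rwa [ENNReal.rpow_one] at this
  refine ⟨η₀, hη₀, fun Q u p G hsw hG z R₀ hR₀ hQ hD₀ hA hEη => ?_⟩
  -- ### the pressure iteration along `ϱₙ = θⁿ R₀`
  set ϱ : ℕ → ℝ := fun n => θ ^ n * R₀ with hϱdef
  have hϱ0 : ∀ n, 0 < ϱ n := fun n => by positivity
  have hϱR₀ : ∀ n, ϱ n ≤ R₀ := fun n => by
    have : θ ^ n ≤ 1 := pow_le_one₀ hθ0.le hθ1
    calc ϱ n = θ ^ n * R₀ := rfl
      _ ≤ 1 * R₀ := by gcongr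
      _ = R₀ := one_mul R₀
  have hQϱ : ∀ n, parabolicCylinder (ϱ n) z ⊆ (Q : Set (ℝ × EuclideanSpace ℝ (Fin 3))) := fun n =>
    (parabolicCylinder_mono (hϱ0 n).le (hϱR₀ n) z).trans hQ
  set B : ℝ≥0∞ := (κ₇ : ℝ≥0∞) * Yθ * (K : ℝ≥0∞) ^ (1 / 2 : ℝ) * η with hBdef
  set d : ℕ → ℝ≥0∞ := fun n => cknD (ϱ n) z p with hddef
  have hA12 : ∀ ρ, 0 < ρ → ρ ≤ R₀ → cknAEss ρ z u ^ (1 / 2 : ℝ) ≤ (K : ℝ≥0∞) ^ (1 / 2 : ℝ) :=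
    fun ρ hρ hρR => ENNReal.rpow_le_rpow (hA ρ hρ hρR) (by norm_num)
  have hstep : ∀ n, d (n + 1) ≤ B + ENNReal.ofReal (1 / 4) * d n := by
    intro n
    have key := HP Q u p G hsw hG z (ϱ n) θ (hϱ0 n) hθ0 hθhalf (hQϱ n)
    have hϱsucc : ϱ (n + 1) = θ * ϱ n := by
      simp only [hϱdef, pow_succ]; ring
    calc d (n + 1) = cknD (θ * ϱ n) z p := by rw [hddef]; simp only [hϱsucc]
      _ ≤ κ₇ * Yθ * cknAEss (ϱ n) z u ^ (1 / 2 : ℝ) * cknE (ϱ n) z G +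
            κ₈ * ENNReal.ofReal θ * cknD (ϱ n) z p := key
      _ ≤ κ₇ * Yθ * (K : ℝ≥0∞) ^ (1 / 2 : ℝ) * η + ENNReal.ofReal (1 / 4) * cknD (ϱ n) z p :=
          add_le_add (mul_le_mul' (mul_le_mul' le_rfl (hA12 _ (hϱ0 n) (hϱR₀ n)))
            (hEη _ (hϱ0 n) (hϱR₀ n))) (mul_le_mul' hκ₈θ le_rfl)
      _ = B + ENNReal.ofReal (1 / 4) * d n := rfl
  have hd : ∀ n, d n ≤ ENNReal.ofReal (1 / 4) ^ n * d 0 + 2 * B := iterate_quarter_le hstep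
  -- ### the index `n`: `κ₈ X (¼)ⁿ D(R₀) ≤ q5`
  have hd0 : d 0 = cknD R₀ z p := by simp [hddef, hϱdef]
  have hd0top : d 0 ≠ ∞ := by rw [hd0]; exact hD₀
  have hlim : Tendsto (fun n : ℕ => ENNReal.ofReal (1 / 4) ^ n * ((κ₈ : ℝ≥0∞) * X * d 0)) atTop (𝓝 0) := by
    have h1 : Tendsto (fun n : ℕ => (ENNReal.ofReal (1 / 4)) ^ n) atTop (𝓝 0) :=
      ENNReal.tendsto_pow_atTop_nhds_zero_of_lt_one
        (by rw [← ENNReal.ofReal_one]; exact ENNReal.ofReal_lt_ofReal_iff'.2 ⟨by norm_num, by norm_num⟩)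
    have h2 := ENNReal.Tendsto.mul_const (b := (κ₈ : ℝ≥0∞) * X * d 0) h1 (Or.inr (ENNReal.mul_ne_top
      (ENNReal.mul_ne_top ENNReal.coe_ne_top ENNReal.ofReal_ne_top) hd0top))
    rwa [zero_mul] at h2
  obtain ⟨n, hn⟩ : ∃ n : ℕ, ENNReal.ofReal (1 / 4) ^ n * ((κ₈ : ℝ≥0∞) * X * d 0) ≤ q5 := by
    have hev := (tendsto_order.1 hlim).2 q5 (pos_iff_ne_zero.2 hq50)
    obtain ⟨n, hn⟩ := hev.exists
    exact ⟨n, hn.le⟩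
  have HT4 : (κ₈ : ℝ≥0∞) * X * (ENNReal.ofReal (1 / 4) ^ n * d 0) ≤ q5 := by
    calc (κ₈ : ℝ≥0∞) * X * (ENNReal.ofReal (1 / 4) ^ n * d 0)
        = ENNReal.ofReal (1 / 4) ^ n * ((κ₈ : ℝ≥0∞) * X * d 0) := by ring
      _ ≤ q5 := hn
  -- ### the final scale `r = κ ϱₙ`
  set ρ : ℝ := ϱ n with hρdef
  have hρ0 : 0 < ρ := hϱ0 n
  have hρR₀ : ρ ≤ R₀ := hϱR₀ n
  set r : ℝ := κ * ρ with hrdef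
  have hr0 : 0 < r := mul_pos hκ0 hρ0
  have hrρ : r ≤ ρ := by rw [hrdef]; nlinarith
  have hrR₀ : r ≤ R₀ := hrρ.trans hρR₀
  have hAρtop : cknAEss ρ z u ≠ ∞ := ne_top_of_le_ne_top ENNReal.coe_ne_top (hA ρ hρ0 hρR₀)
  have hEρtop : cknE ρ z G ≠ ∞ := ne_top_of_le_ne_top ENNReal.ofReal_ne_top (hEη ρ hρ0 hρR₀)
  -- (C) the cubic quantity at scale `r`
  have hC : cknC r z u ≤ q5 + q5 := by
    have hGρ : HasWeakSpatialGradientOn (parabolicCylinderOpens ρ z) u G :=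
      hG.mono (fun w hw => (hQϱ n) hw)
    have key := hC₆ u G z ρ r hr0 hrρ hGρ hAρtop hEρtop
    have e1 : r / ρ = κ := by rw [hrdef]; field_simp
    have e2 : ρ / r = κ⁻¹ := by rw [hrdef]; field_simp
    rw [e1, e2] at key
    calc cknC r z u
        ≤ C₆ * (X ^ 3 * cknAEss ρ z u ^ (3 / 2 : ℝ) +
            Xi ^ 3 * cknAEss ρ z u ^ (3 / 4 : ℝ) * cknE ρ z G ^ (3 / 4 : ℝ)) := key
      _ ≤ C₆ * (X ^ 3 * (K : ℝ≥0∞) ^ (3 / 2 : ℝ) +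
            Xi ^ 3 * (K : ℝ≥0∞) ^ (3 / 4 : ℝ) * η ^ (3 / 4 : ℝ)) := by
          gcongr
          all_goals first
            | exact hA ρ hρ0 hρR₀
            | exact hEη ρ hρ0 hρR₀
      _ = (C₆ : ℝ≥0∞) * (K : ℝ≥0∞) ^ (3 / 2 : ℝ) * X ^ 3 +
            (C₆ : ℝ≥0∞) * Xi ^ 3 * (K : ℝ≥0∞) ^ (3 / 4 : ℝ) * η ^ (3 / 4 : ℝ) := by ring
      _ ≤ q5 + q5 := add_le_add HT1 HT2
  -- (D) the pressure quantity at scale `r`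
  have hD : cknD r z p ≤ q5 + q5 + q5 := by
    have key := HP Q u p G hsw hG z ρ κ hρ0 hκ0 hκhalf (hQϱ n)
    calc cknD r z p = cknD (κ * ρ) z p := rfl
      _ ≤ κ₇ * Y * cknAEss ρ z u ^ (1 / 2 : ℝ) * cknE ρ z G + κ₈ * X * cknD ρ z p := key
      _ ≤ κ₇ * Y * (K : ℝ≥0∞) ^ (1 / 2 : ℝ) * η +
            κ₈ * X * (ENNReal.ofReal (1 / 4) ^ n * d 0 + 2 * B) :=
          add_le_add (mul_le_mul' (mul_le_mul' le_rfl (hA12 ρ hρ0 hρR₀)) (hEη ρ hρ0 hρR₀))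
            (mul_le_mul' le_rfl (hd n))
      _ = κ₇ * Y * (K : ℝ≥0∞) ^ (1 / 2 : ℝ) * η +
            (κ₈ * X * (ENNReal.ofReal (1 / 4) ^ n * d 0) +
              (κ₈ : ℝ≥0∞) * X * (2 * ((κ₇ : ℝ≥0∞) * Yθ * (K : ℝ≥0∞) ^ (1 / 2 : ℝ))) * η) := by
          rw [hBdef]; ring
      _ ≤ q5 + (q5 + q5) := add_le_add HT3 (add_le_add HT4 HT5)
      _ = q5 + q5 + q5 := (add_assoc _ _ _).symm
  -- ### the one-scale criterion at the top
  have hsmall : cknC r z u + cknD r z p ≤ ENNReal.ofReal (ε₀ ^ 3) := by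
    calc cknC r z u + cknD r z p ≤ (q5 + q5) + (q5 + q5 + q5) := add_le_add hC hD
      _ = q5 + q5 + q5 + q5 + q5 := by ring
      _ = ENNReal.ofReal (ε₀ ^ 3) := h5q5
  have hAR₀top : cknAEss R₀ z u ≠ ∞ := ne_top_of_le_ne_top ENNReal.coe_ne_top (hA R₀ hR₀ le_rfl)
  have hER₀top : cknE R₀ z G ≠ ∞ := ne_top_of_le_ne_top ENNReal.ofReal_ne_top (hEη R₀ hR₀ le_rfl)
  have hbd := HE Q u p G hsw hG z R₀ hR₀ hQ hAR₀top hER₀top hD₀ r ε₀ hr0 hrR₀ hε₀.le le_rfl hsmall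
  exact ⟨r / 2, by positivity, C₀ * ε₀ / r, hbd⟩

/-- Contrapositive packaging: under the hypotheses of `exists_bound_top_of_cknE_le`, the vertex `z`
is NOT a backward singular point of `u`. -/
theorem not_isBackwardSingularPoint_of_cknE_le (K : ℝ≥0) :
    ∃ η₀ : ℝ, 0 < η₀ ∧
      ∀ (Q : Opens (ℝ × EuclideanSpace ℝ (Fin 3)))
        (u : ℝ → EuclideanSpace ℝ (Fin 3) → EuclideanSpace ℝ (Fin 3))
        (p : ℝ → EuclideanSpace ℝ (Fin 3) → ℝ)
        (G : ℝ → EuclideanSpace ℝ (Fin 3) → EuclideanSpace ℝ (Fin 3) →L[ℝ] EuclideanSpace ℝ (Fin 3)),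
        IsSuitableWeakSolutionOn Q 1 0 u p → HasWeakSpatialGradientOn Q u G →
        ∀ (z : ℝ × EuclideanSpace ℝ (Fin 3)) (R₀ : ℝ), 0 < R₀ →
          parabolicCylinder R₀ z ⊆ (Q : Set (ℝ × EuclideanSpace ℝ (Fin 3))) →
          cknD R₀ z p ≠ ∞ →
          (∀ ρ, 0 < ρ → ρ ≤ R₀ → cknAEss ρ z u ≤ K) →
          (∀ ρ, 0 < ρ → ρ ≤ R₀ → cknE ρ z G ≤ ENNReal.ofReal η₀) →
          ¬ IsBackwardSingularPoint u z := by
  obtain ⟨η₀, hη₀, H⟩ := exists_bound_top_of_cknE_le K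
  refine ⟨η₀, hη₀, fun Q u p G hsw hG z R₀ hR₀ hQ hD₀ hA hE hsing => ?_⟩
  obtain ⟨r, hr, C, hC⟩ := H Q u p G hsw hG z R₀ hR₀ hQ hD₀ hA hE
  have hfin : eLpNorm (uncurry u) ∞ (volume.restrict (parabolicCylinder r z)) < ∞ := by
    refine (eLpNorm_le_of_ae_bound (C := C) ?_).trans_lt ?_
    · filter_upwards [hC] with w hw
      exact hw
    · simp
  exact hfin.ne (hsing r hr)

end Summit.NavierStokesRegularity.NavierStokesRegularity.Cruxes.ScarEnvelopeTypeI.SliceBudget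

end
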